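import Literature.Combinatorics.Optimization.KnapsackPseudoDensity
import HarnessLib

/-!
# Psd rank of stable-set polytopes: Lee–Raghavendra–Steurer 2015 Cor. 1.2 (STAB) DERIVED from Thm 3.8

Companion of `CutTspStabPsdRank.lean` (which TYPES LRS Corollary 1.2 as the three named facts
`LeeRaghavendraSteurer2015_cor12_cut/_tsp/_stab`) and of `KnapsackPseudoDensity.lean` (Thm 1.1 = 5.4
from the engine Thm 3.8 through `thm54_large`: for large `n` and `r < 2^{n^{2/13}/8}` the knapsack
pattern matrix `M_n^f`, `f` = eq. (5.1), has no psd factorisation of size `r`).  This file PROVES the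
stable-set clause "`max_{n-vertex G} rk_psd(STAB_n(G)) ≥ 2^{Ω(n^{1/13})}`" modulo the same single
engine fact, with the graph of Fiorini–Massar–Pokutta–Tiwary–de Wolf:

* `StabKnapsack.graph p pad` — FMPTW's graph `H_p` (Lemma 8, PDF p. 9–10: "For each vertex `i` of
  `K_n` we create two vertices labeled `e_ii, ē_ii` in `H_n` and an edge between them. For each edge
  `ij` of `K_n`, we add to `H_n` four vertices labeled `e_ij, ē_ij, e'_ij, ē'_ij` and all possible six
  edges between them. We further add the following eight edges …") on the vertex type
  `StabKnapsack.SV p pad`: vertex-clique vertices `vc i s` (`s : Bool`, `s = true` is `e_ii`),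
  edge-clique vertices `ec q c` for ORDERED pairs `q = (i,j)` and codes `c : Bool × Bool` (the code
  `(s_i, s_j)` names the unique pair of vertex-clique vertices it is compatible with; FMPTW index
  unordered pairs — the extra cliques are harmless copies), and `pad` isolated padding vertices (as in
  FMPTW Thm 10: "let `G_n` be obtained from `H_p` by adding `n − f(p)` isolated vertices");
  `|SV p pad| = 2p + 4p² + pad`;
* `StabKnapsack.desig b` — the maximum stable sets `U_b` (`b ⊆ [p]`) of Lemma 8's face `F`
  ("stable sets containing exactly one vertex in each vertex-clique and each edge-clique"), with
  readouts `[vc i true ∈ U_b] = [i ∈ b]`, `[ec (i,j) (1,1) ∈ U_b] = [i ∈ b][j ∈ b]` (Lemma 8: "for the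
  edge `ij` of `K_n` we have `e_ij ∈ S` if and only if both vertices `ii` and `jj` belong to `S`");
* `StabKnapsack.stable_ineq` — for an `m`-subset `S ⊆ [p]`, `m` odd, the linear functional
  `Σ_{q ∈ S.offDiag, c ≠ (1,1)} x_{ec q c} + (m−1) Σ_{i ∈ S} x_{vc i true}` is at most
  `m(m−1) + (m²−1)/4` on EVERY stable set of `H_p` (a stable set meeting `vc i true`, `vc j true` can
  meet the edge-clique of `(i,j)` only in code `(1,1)`, so the first sum is `≤ m(m−1) − w(w−1)` with
  `w` = number of `i ∈ S` with `vc i true` in the set, and `w(m−w) ≤ (m²−1)/4` as `(m−2w)² ≥ 1`), with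
  the value `m(m−1) − w(w−1) + (m−1)w` at `U_b`, `w = |S ∩ b|` (`sum_coeff_desig`); the slack
  `((m−2w)² − 1)/4 = m² f(b_S)` is the knapsack pattern of eq. (5.1) — Prop. 5.1's planted quadratic
  read through the face of Lemma 8;
* `HasPsdFactorization.patternMatrix_knapsackGap_of_stabSlack` — for any relabelling
  `e : SV p pad ≃ Fin n`, a size-`r` psd factorisation of the full slack matrix of `STAB_n(G)`,
  `G = StabKnapsack.graphOn e`, restricts to one of `M_p^f`;
* `LeeRaghavendraSteurer2015_cor12_stab_of_thm38 : LeeRaghavendraSteurer2015_thm38 →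
  LeeRaghavendraSteurer2015_cor12_stab` (`α = 1/16`, `p := ⌊√n⌋/3`, `n ≤ 36 p²`).

With `LeeRaghavendraSteurer2015_thm11_of_thm38`, `…_cor12_cut_of_thm38` (KnapsackPseudoDensity.lean)
and `…_cor12_tsp_of_thm38` (TspPsdRankLowerBound.lean) all of Cor. 1.2 rests on the engine fact
`LeeRaghavendraSteurer2015_thm38`.  (LRS's printed route is Thm 1.1 + "some face of `STAB(H_n)`
linearly projects to `CORR_n`" [FMPTW12, Lemma 8]; we plant the knapsack quadratic directly, which is
the composite of Prop. 5.1 and that projection.)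

Sources: J. R. Lee, P. Raghavendra, D. Steurer, STOC 2015 [LeeRaghavendraSteurer2015], held text
`paper:arxiv-1411.6317`: Cor. 1.2 (p. 4), Prop. 5.1/5.2 (p. 22), eq. (5.1), Thm 5.4 (p. 23);
S. Fiorini, S. Massar, S. Pokutta, H. R. Tiwary, R. de Wolf, J. ACM 62 (2015) [FioriniEtAl2015], held
text `paper:arxiv-1111.0837`: §3.3 Lemma 8, Lemma 9, Thm 10 (PDF p. 9–10).  Nothing is vendored as a
fact; the only instances are the derived `DecidableEq` / `Fintype` of the vertex type.
-/

noncomputable section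

open Finset Matrix

namespace Literature.Combinatorics.Optimization

namespace StabKnapsack

/-- The vertex type of FMPTW's graph `H_p` plus `pad` isolated vertices: vertex-clique vertices
`vc i s` (`s = true` is `e_ii`, `s = false` is `ē_ii`), edge-clique vertices `ec q c` of the ordered
pair `q = (i, j)` with code `c = (c₁, c₂)` (code `(1,1)` is FMPTW's `e_ij`), padding `pd t`.
[cite: FioriniEtAl2015, Lemma 8 (PDF p. 9–10)] -/
inductive SV (p pad : ℕ) : Type
  /-- vertex-clique vertex of `i`: `e_ii` (`s = true`) or `ē_ii` (`s = false`) -/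
  | vc (i : Fin p) (s : Bool)
  /-- edge-clique vertex of the ordered pair `q` with compatibility code `c` -/
  | ec (q : Fin p × Fin p) (c : Bool × Bool)
  /-- isolated padding vertex -/
  | pd (t : Fin pad)
  deriving DecidableEq, Fintype

open SV

variable {p pad : ℕ}

/-- `SV p pad` as a sum of products. [cite: FioriniEtAl2015, Lemma 8 (PDF p. 10: vertex count)] -/
def equivSum : SV p pad ≃ (Fin p × Bool) ⊕ ((Fin p × Fin p) × (Bool × Bool)) ⊕ Fin pad where
  toFun
    | vc i s => Sum.inl (i, s)
    | ec q c => Sum.inr (Sum.inl (q, c))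
    | pd t => Sum.inr (Sum.inr t)
  invFun
    | Sum.inl (i, s) => vc i s
    | Sum.inr (Sum.inl (q, c)) => ec q c
    | Sum.inr (Sum.inr t) => pd t
  left_inv v := by cases v <;> rfl
  right_inv w := by rcases w with ⟨i, s⟩ | ⟨q, c⟩ | t <;> rfl

/-- `|SV p pad| = 2p + 4p² + pad` ("The number of vertices in `H_n` is `2n + 4 C(n,2)`"; here ordered
pairs). [cite: FioriniEtAl2015, Lemma 8 (PDF p. 10)] -/
theorem card_SV (p pad : ℕ) : Fintype.card (SV p pad) = 2 * p + 4 * p ^ 2 + pad := by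
  rw [Fintype.card_congr (equivSum (p := p) (pad := pad))]
  simp only [Fintype.card_sum, Fintype.card_prod, Fintype.card_fin, Fintype.card_bool]
  ring

/-- FMPTW's edges: inside each vertex-clique and each edge-clique, and from the edge-clique vertex of
code `(c₁, c₂)` of `(i, j)` to the vertex-clique vertices `vc i s`, `s ≠ c₁`, and `vc j s`, `s ≠ c₂`
("the following eight edges"); padding vertices are isolated. [cite: FioriniEtAl2015, Lemma 8 (PDF p. 9–10)] -/
def rel : SV p pad → SV p pad → Prop
  | vc i s, vc i' s' => i = i' ∧ s ≠ s'
  | vc _ _, ec _ _ => False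
  | vc _ _, pd _ => False
  | ec q c, vc k s => (k = q.1 ∧ s ≠ c.1) ∨ (k = q.2 ∧ s ≠ c.2)
  | ec q c, ec q' c' => q = q' ∧ c ≠ c'
  | ec _ _, pd _ => False
  | pd _, _ => False

/-- **FMPTW's graph `H_p`** (with `pad` isolated vertices). [cite: FioriniEtAl2015, Lemma 8 (PDF p. 9–10)] -/
def graph (p pad : ℕ) : SimpleGraph (SV p pad) := SimpleGraph.fromRel rel

/-- The same graph relabelled on `Fin n` along `e : SV p pad ≃ Fin n` (FMPTW Thm 10's `G_n`: `H_p` plus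
isolated vertices). [cite: FioriniEtAl2015, Thm 10 (PDF p. 10)] -/
def graphOn {n : ℕ} (e : SV p pad ≃ Fin n) : SimpleGraph (Fin n) := (graph p pad).comap e.symm

/-- Two distinct vertices of one edge-clique are adjacent. [cite: FioriniEtAl2015, Lemma 8 (PDF p. 9: "all possible six edges between them")] -/
theorem adj_ec_ec {q : Fin p × Fin p} {c c' : Bool × Bool} (h : c ≠ c') :
    (graph p pad).Adj (ec q c) (ec q c') := by
  rw [graph, SimpleGraph.fromRel_adj]
  refine ⟨fun heq => h ?_, Or.inl ⟨rfl, h⟩⟩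
  simpa using heq

/-- An edge-clique vertex whose first code bit is `0` is adjacent to `e_ii`. [cite: FioriniEtAl2015, Lemma 8 (PDF p. 10: the eight edges)] -/
theorem adj_ec_vc_fst {q : Fin p × Fin p} {c : Bool × Bool} (h : c.1 = false) :
    (graph p pad).Adj (ec q c) (vc q.1 true) := by
  rw [graph, SimpleGraph.fromRel_adj]
  exact ⟨by simp, Or.inl (Or.inl ⟨rfl, by simp [h]⟩)⟩

/-- An edge-clique vertex whose second code bit is `0` is adjacent to `e_jj`. [cite: FioriniEtAl2015, Lemma 8 (PDF p. 10: the eight edges)] -/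
theorem adj_ec_vc_snd {q : Fin p × Fin p} {c : Bool × Bool} (h : c.2 = false) :
    (graph p pad).Adj (ec q c) (vc q.2 true) := by
  rw [graph, SimpleGraph.fromRel_adj]
  exact ⟨by simp, Or.inl (Or.inr ⟨rfl, by simp [h]⟩)⟩

/-! ### The designated (maximum) stable sets `U_b` -/

/-- The code `([i ∈ b], [j ∈ b])` of the ordered pair `(i, j)` under `b ⊆ [p]`. [cite: FioriniEtAl2015, Lemma 8 (PDF p. 10)] -/
def code (b : Finset (Fin p)) (q : Fin p × Fin p) : Bool × Bool := (decide (q.1 ∈ b), decide (q.2 ∈ b))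

/-- `code b (i,j) = (1,1)` iff `i, j ∈ b`. [cite: FioriniEtAl2015, Lemma 8 (PDF p. 10: "e_ij ∈ S if and only if both vertices ii and jj belong to S")] -/
theorem code_eq_true_iff (b : Finset (Fin p)) (q : Fin p × Fin p) :
    code b q = (true, true) ↔ q.1 ∈ b ∧ q.2 ∈ b := by
  simp [code, Prod.ext_iff]

/-- Membership test of the designated stable set `U_b`: the vertex-clique vertex of `i` with
`s = [i ∈ b]`, the edge-clique vertex of `q` with code `code b q`, no padding.
[cite: FioriniEtAl2015, Lemma 8 (PDF p. 10: "the unique maximum stable set S that contains e_ii if b_i = 1 and ē_ii if b_i = 0")] -/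
def desigB (b : Finset (Fin p)) : SV p pad → Bool
  | vc i s => s == decide (i ∈ b)
  | ec q c => c == code b q
  | pd _ => false

/-- The designated stable set `U_b` of `H_p` (`b ⊆ [p]`). [cite: FioriniEtAl2015, Lemma 8 (PDF p. 10)] -/
def desig (b : Finset (Fin p)) : Finset (SV p pad) := univ.filter fun v => desigB b v = true

/-- Readout of the bit `i`: `vc i s ∈ U_b ↔ s = [i ∈ b]`. [cite: FioriniEtAl2015, Lemma 8 (PDF p. 10: "b_i := 1 if e_ii ∈ S")] -/
theorem vc_mem_desig (b : Finset (Fin p)) (i : Fin p) (s : Bool) :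
    (vc i s : SV p pad) ∈ desig b ↔ s = decide (i ∈ b) := by
  simp [desig, desigB]

/-- Readout of a pair: `ec q c ∈ U_b ↔ c = code b q`. [cite: FioriniEtAl2015, Lemma 8 (PDF p. 10)] -/
theorem ec_mem_desig (b : Finset (Fin p)) (q : Fin p × Fin p) (c : Bool × Bool) :
    (ec q c : SV p pad) ∈ desig b ↔ c = code b q := by
  simp [desig, desigB]

/-- `U_b` is a stable set of `H_p`. [cite: FioriniEtAl2015, Lemma 8 (PDF p. 10)] -/
theorem desig_stable (b : Finset (Fin p)) :
    ∀ u ∈ (desig b : Finset (SV p pad)), ∀ v ∈ desig b, ¬ (graph p pad).Adj u v := by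
  suffices H : ∀ u v : SV p pad, u ∈ desig b → v ∈ desig b → ¬ rel u v by
    intro u hu v hv hadj
    rw [graph, SimpleGraph.fromRel_adj] at hadj
    rcases hadj.2 with h | h
    · exact H u v hu hv h
    · exact H v u hv hu h
  intro u v hu hv h
  cases u with
  | vc i s =>
    cases v with
    | vc i' s' =>
      rw [vc_mem_desig] at hu hv
      simp only [rel] at h
      obtain ⟨rfl, hs⟩ := h
      exact hs (hu.trans hv.symm)
    | ec q c => exact h
    | pd t => exact h
  | ec q c =>
    cases v with
    | vc k s =>
      rw [ec_mem_desig] at hu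
      rw [vc_mem_desig] at hv
      simp only [rel] at h
      rcases h with ⟨rfl, hs⟩ | ⟨rfl, hs⟩
      · exact hs (by rw [hv, hu]; rfl)
      · exact hs (by rw [hv, hu]; rfl)
    | ec q' c' =>
      rw [ec_mem_desig] at hu hv
      simp only [rel] at h
      obtain ⟨rfl, hc⟩ := h
      exact hc (hu.trans hv.symm)
    | pd t => exact h
  | pd t => exact h

/-! ### The knapsack inequality of an odd subset `S ⊆ [p]` -/

/-- The three codes other than `(1,1)`. [cite: FioriniEtAl2015, Lemma 8 (PDF p. 9: ē_ij, e'_ij, ē'_ij)] -/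
def C3 : Finset (Bool × Bool) := univ.erase (true, true)

/-- Membership in `C3`. [cite: FioriniEtAl2015, Lemma 8 (PDF p. 9)] -/
@[simp] theorem mem_C3 (c : Bool × Bool) : c ∈ C3 ↔ c ≠ (true, true) := by
  simp [C3]

/-- The coefficient vector on the vertices of `H_p` of the knapsack inequality of `S ⊆ [p]`
(`m = |S|`): `+1` on `ec q c` for `q ∈ S.offDiag`, `c ≠ (1,1)`; `+(m−1)` on `vc i true` for `i ∈ S`
(Prop. 5.1's planted quadratic of eq. (5.1) pulled back along the projection of Lemma 8's face).
[cite: LeeRaghavendraSteurer2015, Prop. 5.1/5.2 (p. 22) and eq. (5.1) (p. 23)] -/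
def coeff (S : Finset (Fin p)) (v : SV p pad) : ℝ :=
  (((S.offDiag ×ˢ C3).filter fun qc : (Fin p × Fin p) × (Bool × Bool) => ec qc.1 qc.2 = v).card : ℝ)
    + ((S.card : ℝ) - 1) * ((S.filter fun i => vc i true = v).card : ℝ)

/-- The right-hand side `m(m−1) + (m²−1)/4` of the knapsack inequality of `S`.
[cite: LeeRaghavendraSteurer2015, eq. (5.1) (p. 23)] -/
def rhs (S : Finset (Fin p)) : ℝ := (S.card : ℝ) * ((S.card : ℝ) - 1) + (((S.card : ℝ)) ^ 2 - 1) / 4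

/-- Double counting: summing over `y ∈ T` the number of `x ∈ s` with `f x = y` counts the `x ∈ s`
with `f x ∈ T` (private plumbing). [folklore] -/
private theorem sum_card_filter_eq' {α β : Type*} [DecidableEq β] (s : Finset α) (T : Finset β)
    (f : α → β) :
    ∑ y ∈ T, ((s.filter fun x => f x = y).card : ℝ) = ((s.filter fun x => f x ∈ T).card : ℝ) := by
  classical
  rw [← Nat.cast_sum]
  congr 1
  simp only [Finset.card_filter]
  rw [Finset.sum_comm]
  refine Finset.sum_congr rfl fun x _ => ?_
  rw [Finset.sum_ite_eq]

/-- The value of the knapsack functional on a vertex set `U` as two counts (private plumbing).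
[folklore] -/
private theorem sum_coeff (S : Finset (Fin p)) (U : Finset (SV p pad)) :
    ∑ v ∈ U, coeff S v =
      (((S.offDiag ×ˢ C3).filter fun qc : (Fin p × Fin p) × (Bool × Bool) => ec qc.1 qc.2 ∈ U).card : ℝ)
        + ((S.card : ℝ) - 1) * ((S.filter fun i => vc i true ∈ U).card : ℝ) := by
  classical
  simp only [coeff, Finset.sum_add_distrib, ← Finset.mul_sum]
  rw [sum_card_filter_eq', sum_card_filter_eq']

/-- In a stable set, each edge-clique is met at most once: `(q, c) ↦ q` is injective on the pairs
`(q, c)` with `ec q c ∈ U`. [cite: FioriniEtAl2015, Lemma 8 (PDF p. 10: "exactly one vertex in … each edge-clique")] -/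
theorem injOn_fst_of_stable {U : Finset (SV p pad)} (hU : ∀ u ∈ U, ∀ v ∈ U, ¬ (graph p pad).Adj u v)
    (S : Finset (Fin p)) :
    Set.InjOn (fun qc : (Fin p × Fin p) × (Bool × Bool) => qc.1)
      ↑((S.offDiag ×ˢ C3).filter fun qc : (Fin p × Fin p) × (Bool × Bool) => ec qc.1 qc.2 ∈ U) := by
  rintro ⟨q, c⟩ hqc ⟨q', c'⟩ hqc' (heq : q = q')
  subst heq
  rw [Finset.mem_coe, mem_filter] at hqc hqc'
  by_contra hne
  have hc : c ≠ c' := fun h => hne (by rw [h])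
  exact hU _ hqc.2 _ hqc'.2 (adj_ec_ec hc)

/-- A stable set containing `e_ii` and `e_jj` meets the edge-clique of `(i, j)` only in code `(1,1)`:
the projection of the pairs `(q, c)`, `c ≠ (1,1)`, with `ec q c ∈ U` avoids `W.offDiag`,
`W = {i ∈ S : vc i true ∈ U}`. [cite: FioriniEtAl2015, Lemma 8 (PDF p. 10: "e_ij ∈ S if and only if both vertices ii and jj belong to S")] -/
theorem image_fst_subset_of_stable {U : Finset (SV p pad)}
    (hU : ∀ u ∈ U, ∀ v ∈ U, ¬ (graph p pad).Adj u v) (S : Finset (Fin p)) :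
    ((S.offDiag ×ˢ C3).filter fun qc : (Fin p × Fin p) × (Bool × Bool) => ec qc.1 qc.2 ∈ U).image
        (fun qc => qc.1) ⊆ S.offDiag \ (S.filter fun i => vc i true ∈ U).offDiag := by
  intro q hq
  rw [mem_image] at hq
  obtain ⟨⟨q', ⟨c1, c2⟩⟩, hqc, rfl⟩ := hq
  rw [mem_filter, mem_product, mem_C3] at hqc
  obtain ⟨⟨hq, hc⟩, hqU⟩ := hqc
  rw [mem_sdiff]
  refine ⟨hq, fun hqW => ?_⟩
  rw [mem_offDiag, mem_filter, mem_filter] at hqW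
  obtain ⟨⟨-, h1⟩, ⟨-, h2⟩, -⟩ := hqW
  have hc' : c1 = false ∨ c2 = false := by
    cases c1 <;> cases c2 <;> simp at hc ⊢
  rcases hc' with h | h
  · exact hU _ hqU _ h1 (adj_ec_vc_fst h)
  · exact hU _ hqU _ h2 (adj_ec_vc_snd h)

/-- **The knapsack inequality on every stable set of `H_p`.**  With `w = #{i ∈ S : vc i true ∈ U}` the
functional is at most `(m(m−1) − w(w−1)) + (m−1)w = m(m−1) + w(m−w) ≤ m(m−1) + (m²−1)/4` for odd
`m = |S|` (`(m−2w)² ≥ 1`). [cite: LeeRaghavendraSteurer2015, Prop. 5.1 (p. 22: "q(x) ≥ 0 for all x ∈ {0,1}ⁿ") and Prop. 5.2 (p. 22)] -/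
theorem stable_ineq {U : Finset (SV p pad)} (hU : ∀ u ∈ U, ∀ v ∈ U, ¬ (graph p pad).Adj u v)
    {S : Finset (Fin p)} (hS : Odd S.card) : ∑ v ∈ U, coeff S v ≤ rhs S := by
  classical
  rw [sum_coeff]
  have hWS : (S.filter fun i => vc i true ∈ U) ⊆ S := filter_subset _ S
  have hWoff : (S.filter fun i => vc i true ∈ U).offDiag ⊆ S.offDiag := offDiag_mono hWS
  have hcardA : ((S.offDiag ×ˢ C3).filter
        fun qc : (Fin p × Fin p) × (Bool × Bool) => ec qc.1 qc.2 ∈ U).card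
      + (S.filter fun i => vc i true ∈ U).offDiag.card ≤ S.offDiag.card := by
    have h1 := card_le_card (image_fst_subset_of_stable hU S)
    rw [card_image_of_injOn (injOn_fst_of_stable hU S), card_sdiff_of_subset hWoff] at h1
    have := card_le_card hWoff
    omega
  -- abbreviations for the arithmetic
  obtain ⟨a, ha⟩ : ∃ a : ℕ, a = ((S.offDiag ×ˢ C3).filter
      fun qc : (Fin p × Fin p) × (Bool × Bool) => ec qc.1 qc.2 ∈ U).card := ⟨_, rfl⟩
  obtain ⟨w, hw⟩ : ∃ w : ℕ, w = (S.filter fun i => vc i true ∈ U).card := ⟨_, rfl⟩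
  rw [← ha] at hcardA ⊢
  rw [← hw]
  have h3 : (S.filter fun i => vc i true ∈ U).offDiag.card = w * w - w := by rw [offDiag_card, ← hw]
  have h4 : S.offDiag.card = S.card * S.card - S.card := offDiag_card S
  have hkW : w ≤ w * w := Nat.le_mul_self _
  have hkS : S.card ≤ S.card * S.card := Nat.le_mul_self _
  have e1 : (a : ℝ) + ((w : ℝ) * w - w) ≤ (S.card : ℝ) * S.card - S.card := by
    have h1' : (((a + (w * w - w)) : ℕ) : ℝ) ≤ ((S.card * S.card - S.card : ℕ) : ℝ) := by
      rw [← h3, ← h4]; exact_mod_cast hcardA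
    push_cast [Nat.cast_sub hkW, Nat.cast_sub hkS] at h1'
    linarith
  -- oddness: `(m − 2w)² ≥ 1`
  have hodd : (1 : ℝ) ≤ ((S.card : ℝ) - 2 * w) ^ 2 := by
    obtain ⟨t, ht⟩ := hS
    have hne : ((S.card : ℤ) - 2 * w) ≠ 0 := by omega
    have habs : (1 : ℤ) ≤ |(S.card : ℤ) - 2 * w| := Int.one_le_abs hne
    have hsq : (1 : ℤ) ≤ ((S.card : ℤ) - 2 * w) ^ 2 := by
      calc (1 : ℤ) = 1 * 1 := by ring
        _ ≤ |(S.card : ℤ) - 2 * w| * |(S.card : ℤ) - 2 * w| :=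
            mul_le_mul habs habs zero_le_one (abs_nonneg _)
        _ = ((S.card : ℤ) - 2 * w) ^ 2 := by rw [← sq, sq_abs]
    have : ((1 : ℤ) : ℝ) ≤ ((((S.card : ℤ) - 2 * w) ^ 2 : ℤ) : ℝ) := by exact_mod_cast hsq
    push_cast at this
    exact this
  rw [rhs]
  nlinarith [e1, hodd]

/-! ### The value at the designated stable sets -/

/-- The pair count at `U_b`: `#{(q,c) ∈ S.offDiag × C3 : ec q c ∈ U_b} = |S.offDiag| − |(S ∩ b).offDiag|`
(the edge-clique of `q = (i,j)` is met by `U_b` in a code `≠ (1,1)` iff not both `i, j ∈ b`).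
[cite: FioriniEtAl2015, Lemma 8 (PDF p. 10)] -/
theorem card_filter_ec_desig (S b : Finset (Fin p)) :
    ((S.offDiag ×ˢ C3).filter
        fun qc : (Fin p × Fin p) × (Bool × Bool) => (ec qc.1 qc.2 : SV p pad) ∈ desig b).card =
      S.offDiag.card - (S ∩ b).offDiag.card := by
  classical
  have hsub : (S ∩ b).offDiag ⊆ S.offDiag := offDiag_mono inter_subset_left
  rw [← card_sdiff_of_subset hsub]
  -- the filtered set is the graph of `code b` over `S.offDiag \ (S ∩ b).offDiag`
  have heq : ((S.offDiag ×ˢ C3).filter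
      fun qc : (Fin p × Fin p) × (Bool × Bool) => (ec qc.1 qc.2 : SV p pad) ∈ desig b) =
      (S.offDiag \ (S ∩ b).offDiag).map ⟨fun q => (q, code b q), fun q q' h => (Prod.ext_iff.1 h).1⟩ := by
    ext ⟨q, c⟩
    simp only [mem_filter, mem_product, mem_C3, ec_mem_desig, mem_map, Function.Embedding.coeFn_mk,
      Prod.mk.injEq, mem_sdiff]
    have key : q ∈ S.offDiag → (q ∈ (S ∩ b).offDiag ↔ code b q = (true, true)) := by
      intro hq
      rw [code_eq_true_iff, mem_offDiag, mem_inter, mem_inter]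
      rw [mem_offDiag] at hq
      exact ⟨fun h => ⟨h.1.2, h.2.1.2⟩, fun h => ⟨⟨hq.1, h.1⟩, ⟨hq.2.1, h.2⟩, hq.2.2⟩⟩
    constructor
    · rintro ⟨⟨hq, hc⟩, hcode⟩
      refine ⟨q, ⟨hq, fun h => hc ?_⟩, rfl, hcode.symm⟩
      rw [hcode]; exact (key hq).1 h
    · rintro ⟨q', ⟨hq', hnot⟩, rfl, rfl⟩
      exact ⟨⟨hq', fun h => hnot ((key hq').2 h)⟩, rfl⟩
  rw [heq, card_map]

/-- The bit count at `U_b`: `#{i ∈ S : vc i true ∈ U_b} = |S ∩ b|`. [cite: FioriniEtAl2015, Lemma 8 (PDF p. 10)] -/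
theorem card_filter_vc_desig (S b : Finset (Fin p)) :
    (S.filter fun i => (vc i true : SV p pad) ∈ desig b).card = (S ∩ b).card := by
  congr 1
  ext i
  rw [mem_filter, vc_mem_desig, mem_inter]
  simp

/-- **The value at `U_b`**: `(m(m−1) − w(w−1)) + (m−1)w` with `w = |S ∩ b|`, so the slack is
`(m²−1)/4 − w(m−w) = ((m−2w)² − 1)/4 = m² f(b_S)`. [cite: LeeRaghavendraSteurer2015, eq. (5.1) and Thm 5.4 proof (p. 23)] -/
theorem sum_coeff_desig (S b : Finset (Fin p)) :
    ∑ v ∈ (desig b : Finset (SV p pad)), coeff S v =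
      ((S.card : ℝ) * S.card - S.card) - (((S ∩ b).card : ℝ) * (S ∩ b).card - (S ∩ b).card)
        + ((S.card : ℝ) - 1) * (S ∩ b).card := by
  rw [sum_coeff, card_filter_ec_desig, card_filter_vc_desig]
  have hsub : (S ∩ b).offDiag ⊆ S.offDiag := offDiag_mono inter_subset_left
  have h1 := card_le_card hsub
  have h3 : (S ∩ b).offDiag.card = (S ∩ b).card * (S ∩ b).card - (S ∩ b).card := offDiag_card _
  have h4 : S.offDiag.card = S.card * S.card - S.card := offDiag_card S
  have hk : (S ∩ b).card ≤ (S ∩ b).card * (S ∩ b).card := Nat.le_mul_self _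
  have hkS : S.card ≤ S.card * S.card := Nat.le_mul_self _
  rw [Nat.cast_sub h1, h3, h4, Nat.cast_sub hk, Nat.cast_sub hkS]
  push_cast
  ring

end StabKnapsack

/-! ### The pattern-matrix entry as a function of `|S ∩ b|` -/

/-- The Hamming weight of `x_S` is `#{i ∈ S : x_i = 1}` (private copy of the lemma of
`TspPsdRankLowerBound.lean`). [cite: LeeRaghavendraSteurer2015, §1 (eq. (restriction): x_S)] -/
private theorem sum_cubePoint_orderEmb {n m : ℕ} (S : Finset (Fin n)) (hS : S.card = m)
    (x : Fin n → Bool) :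
    ∑ j, cubePoint (fun j => x (S.orderEmbOfFin hS j)) j = ((S.filter fun i => x i = true).card : ℝ) := by
  classical
  calc ∑ j, cubePoint (fun j => x (S.orderEmbOfFin hS j)) j
      = ∑ i : S, (if x i = true then (1 : ℝ) else 0) := by
        refine Fintype.sum_equiv (S.orderIsoOfFin hS).toEquiv _ _ fun j => ?_
        simp only [cubePoint]
        rfl
    _ = ∑ i ∈ S, (if x i = true then (1 : ℝ) else 0) :=
        Finset.sum_coe_sort S (fun i => if x i = true then (1 : ℝ) else 0)
    _ = ((S.filter fun i => x i = true).card : ℝ) := by rw [Finset.sum_boole]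

/-- The knapsack pattern-matrix entry `f(x_S) = ((m − 2w)² − 1)/(4m²)`, `w = #{i ∈ S : x_i = 1}`
(private copy). [cite: LeeRaghavendraSteurer2015, eq. (5.1) (p. 23)] -/
private theorem patternMatrix_knapsackGap_eq' {n m : ℕ} (S : {S : Finset (Fin n) // S.card = m})
    (x : Fin n → Bool) :
    patternMatrix n (knapsackGap m) S x =
      (1 / (m : ℝ) ^ 2) * ((((S.1.filter fun i => x i = true).card : ℝ) - (m : ℝ) / 2) ^ 2 - 1 / 4) := by
  rw [patternMatrix_apply, knapsackGap, sum_cubePoint_orderEmb S.1 S.2 x]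

/-- A linear functional against the vertex `𝟙_U` of `STAB_n(G)` is the sum of its coefficients over
`U`. [cite: LeeRaghavendraSteurer2015, §1.1 (p. 4: STAB_n(G) = conv{𝟙_S})] -/
theorem dotProduct_stableSetVector {n : ℕ} {G : SimpleGraph (Fin n)} (a : Fin n → ℝ)
    (U : StableSets G) : a ⬝ᵥ stableSetVector U = ∑ v ∈ U.1, a v := by
  classical
  simp only [dotProduct, stableSetVector, mul_ite, mul_one, mul_zero]
  rw [← Finset.sum_filter, Finset.filter_univ_mem]

/-! ### The transfer: STAB slack ⟶ knapsack pattern matrix -/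

open StabKnapsack StabKnapsack.SV in
/-- **LRS Prop. 5.2 (STAB), factorisation form for the knapsack pattern (PROVED).**  For every
relabelling `e : SV p pad ≃ Fin n` of FMPTW's graph and odd `m`, a positive-semidefinite factorisation
of size `r` of the full slack matrix of `STAB_n(G)`, `G = graphOn e` (rows: all valid linear
inequalities on the stable sets of `G`; columns: the stable sets), restricts to one of the knapsack
pattern matrix `M_p^f`, `f(x) = m^{-2}((Σ x_i − m/2)² − 1/4)`: row `S` ↦ the knapsack inequality of `S`
scaled by `1/m²`, column `x` ↦ the designated stable set `U_{{i : x_i = 1}}`.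
[cite: LeeRaghavendraSteurer2015, Prop. 5.2 (p. 22: "some face of STAB_{b_n}(H_n) linearly projects to CORR_n") and Thm 5.4 proof (p. 23)] -/
theorem HasPsdFactorization.patternMatrix_knapsackGap_of_stabSlack {p pad n m r : ℕ}
    (e : SV p pad ≃ Fin n) (hm : Odd m)
    (h : HasPsdFactorization (fullSlackMatrix (stableSetVector (G := graphOn e))) r) :
    HasPsdFactorization (patternMatrix p (knapsackGap m)) r := by
  classical
  have hm1 : 1 ≤ m := by obtain ⟨t, ht⟩ := hm; omega
  have hm0 : (0 : ℝ) < m := by exact_mod_cast hm1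
  set u : ℝ := 1 / (m : ℝ) ^ 2 with hu
  have hu0 : 0 ≤ u := by positivity
  -- rows: the scaled knapsack functionals, relabelled
  let a : Finset (Fin p) → Fin n → ℝ := fun S v => u * coeff S (e.symm v)
  -- columns: the designated stable sets, relabelled
  let Ub : Finset (Fin p) → Finset (Fin n) := fun b => (desig b).map e.toEmbedding
  have hUb : ∀ b, ∀ i ∈ Ub b, ∀ j ∈ Ub b, ¬ (graphOn e).Adj i j := by
    intro b i hi j hj hadj
    simp only [Ub, mem_map_equiv] at hi hj
    rw [graphOn, SimpleGraph.comap_adj] at hadj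
    exact desig_stable b _ hi _ hj hadj
  -- evaluation
  have heval : ∀ (S : Finset (Fin p)) (U : StableSets (graphOn e)),
      a S ⬝ᵥ stableSetVector U = u * ∑ y ∈ U.1.map e.symm.toEmbedding, coeff S y := by
    intro S U
    rw [dotProduct_stableSetVector, Finset.sum_map, Finset.mul_sum]
    rfl
  -- validity on every stable set of `G`
  have hvalid : ∀ S : Finset (Fin p), Odd S.card → ∀ U : StableSets (graphOn e),
      a S ⬝ᵥ stableSetVector U ≤ u * rhs S := by
    intro S hS U
    rw [heval]
    refine mul_le_mul_of_nonneg_left (stable_ineq (fun y hy y' hy' hadj => ?_) hS) hu0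
    rw [mem_map_equiv] at hy hy'
    refine U.2 _ hy _ hy' ?_
    rw [graphOn, SimpleGraph.comap_adj]
    simpa using hadj
  -- value at the designated stable sets
  have hback : ∀ b, (Ub b).map e.symm.toEmbedding = desig b := by
    intro b
    ext y
    simp [Ub]
  have hval : ∀ S b : Finset (Fin p),
      a S ⬝ᵥ stableSetVector (⟨Ub b, hUb b⟩ : StableSets (graphOn e)) =
        u * (((S.card : ℝ) * S.card - S.card) - (((S ∩ b).card : ℝ) * (S ∩ b).card - (S ∩ b).card)
          + ((S.card : ℝ) - 1) * (S ∩ b).card) := by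
    intro S b
    rw [heval]
    show u * ∑ y ∈ (Ub b).map e.symm.toEmbedding, coeff S y = _
    rw [hback, sum_coeff_desig]
  -- assemble
  obtain ⟨A, B, hA, hB, hfac⟩ := h
  refine ⟨fun S => A ⟨(a S.1, u * rhs S.1), hvalid S.1 (by rw [S.2]; exact hm)⟩,
    fun x => B ⟨Ub (univ.filter fun i => x i = true), hUb _⟩,
    fun S => hA _, fun x => hB _, fun S x => ?_⟩
  rw [← hfac]
  show patternMatrix p (knapsackGap m) S x =
    u * rhs S.1 - a S.1 ⬝ᵥ stableSetVector (⟨Ub (univ.filter fun i => x i = true), hUb _⟩ :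
      StableSets (graphOn e))
  rw [hval, patternMatrix_knapsackGap_eq', rhs]
  have hSm : (S.1.card : ℝ) = m := by exact_mod_cast S.2
  have hfilt : S.1 ∩ (univ.filter fun i => x i = true) = S.1.filter fun i => x i = true := by
    ext i; simp
  rw [hfilt, hSm, hu]
  ring

/-! ### Corollary 1.2 (STAB) from Theorem 3.8 -/

/-- Elementary exponent comparison: if `n ≤ 100 p²` then `n^{1/13}/16 ≤ p^{2/13}/8` (private copy).
[folklore] -/
private theorem exponent_le' {N n : ℕ} (hN : N ≤ 100 * n ^ 2) :
    (1 / 16 : ℝ) * (N : ℝ) ^ ((1 : ℝ) / 13) ≤ (1 / 8 : ℝ) * (n : ℝ) ^ ((2 : ℝ) / 13) := by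
  have hNr : (N : ℝ) ≤ 100 * (n : ℝ) ^ 2 := by exact_mod_cast hN
  have hn0 : (0 : ℝ) ≤ n := Nat.cast_nonneg n
  have h1 : (N : ℝ) ^ ((1 : ℝ) / 13) ≤ (100 * (n : ℝ) ^ 2) ^ ((1 : ℝ) / 13) :=
    Real.rpow_le_rpow (Nat.cast_nonneg N) hNr (by norm_num)
  have h2 : (100 * (n : ℝ) ^ 2) ^ ((1 : ℝ) / 13) =
      (100 : ℝ) ^ ((1 : ℝ) / 13) * ((n : ℝ) ^ 2) ^ ((1 : ℝ) / 13) :=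
    Real.mul_rpow (by norm_num) (by positivity)
  have h3 : ((n : ℝ) ^ 2) ^ ((1 : ℝ) / 13) = (n : ℝ) ^ ((2 : ℝ) / 13) := by
    rw [← Real.rpow_natCast (n : ℝ) 2, ← Real.rpow_mul hn0]
    norm_num
  have h4 : (100 : ℝ) ^ ((1 : ℝ) / 13) ≤ 2 := by
    have h100 : (100 : ℝ) ≤ (2 : ℝ) ^ (13 : ℕ) := by norm_num
    calc (100 : ℝ) ^ ((1 : ℝ) / 13) ≤ ((2 : ℝ) ^ (13 : ℕ)) ^ ((1 : ℝ) / 13) :=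
          Real.rpow_le_rpow (by norm_num) h100 (by norm_num)
      _ = 2 := by
          rw [← Real.rpow_natCast (2 : ℝ) 13, ← Real.rpow_mul (by norm_num)]
          norm_num
  have h5 : 0 ≤ (n : ℝ) ^ ((2 : ℝ) / 13) := Real.rpow_nonneg hn0 _
  calc (1 / 16 : ℝ) * (N : ℝ) ^ ((1 : ℝ) / 13)
      ≤ (1 / 16) * ((100 : ℝ) ^ ((1 : ℝ) / 13) * (n : ℝ) ^ ((2 : ℝ) / 13)) := by
        rw [← h3, ← h2]; exact mul_le_mul_of_nonneg_left h1 (by norm_num)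
    _ ≤ (1 / 16) * (2 * (n : ℝ) ^ ((2 : ℝ) / 13)) :=
        mul_le_mul_of_nonneg_left (mul_le_mul_of_nonneg_right h4 h5) (by norm_num)
    _ = (1 / 8 : ℝ) * (n : ℝ) ^ ((2 : ℝ) / 13) := by ring

open StabKnapsack in
/-- **Lee–Raghavendra–Steurer 2015, Corollary 1.2 (stable-set polytopes:
`max_{n-vertex G} rk_psd(STAB_n(G)) ≥ 2^{α n^{1/13}}`) DERIVED from Theorem 3.8**: with `α = 1/16`, for
`n ≥ max(900, 9 N₀²)` (`N₀` the threshold of `thm54_large`) and `p := ⌊√n⌋/3` one has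
`2p + 4p² ≤ n ≤ 100 p²`, `p ≥ N₀`; the graph is FMPTW's `H_p` padded to `n` vertices and relabelled,
and a psd factorisation of its full slack matrix of size `r < 2^{n^{1/13}/16} ≤ 2^{p^{2/13}/8}` would
give one of the knapsack pattern matrix `M_p^f` (`HasPsdFactorization.patternMatrix_knapsackGap_of_stabSlack`),
contradicting Thm 3.8 + Thm 5.3 (`thm54_large`). [cite: LeeRaghavendraSteurer2015, Cor. 1.2 (p. 4) and Prop. 5.2 (p. 22)] -/
theorem LeeRaghavendraSteurer2015_cor12_stab_of_thm38 (h38 : LeeRaghavendraSteurer2015_thm38) :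
    LeeRaghavendraSteurer2015_cor12_stab := by
  obtain ⟨N₀, hN₀⟩ := thm54_large h38
  refine ⟨1 / 16, by norm_num, max 900 (9 * N₀ ^ 2), fun n hn => ?_⟩
  have h900 : 900 ≤ n := le_trans (le_max_left _ _) hn
  have hN0 : 9 * N₀ ^ 2 ≤ n := le_trans (le_max_right _ _) hn
  obtain ⟨p, hp⟩ : ∃ p, p = Nat.sqrt n / 3 := ⟨_, rfl⟩
  have hsq : Nat.sqrt n * Nat.sqrt n ≤ n := Nat.sqrt_le n
  have hlt : n < (Nat.sqrt n + 1) * (Nat.sqrt n + 1) := Nat.lt_succ_sqrt n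
  have hp3 : 3 * p ≤ Nat.sqrt n := by rw [hp]; omega
  have hp3' : Nat.sqrt n < 3 * (p + 1) := by rw [hp]; omega
  have h30 : 30 ≤ Nat.sqrt n := by rw [Nat.le_sqrt]; omega
  have hp0 : 0 < p := by omega
  have hle : 2 * p + 4 * p ^ 2 ≤ n := by nlinarith
  have hn100 : n ≤ 100 * p ^ 2 := by
    have h3 : n < 9 * (p + 1) ^ 2 := by nlinarith
    nlinarith
  have hpN₀ : N₀ ≤ p := by
    have : 3 * N₀ ≤ Nat.sqrt n := by
      rw [Nat.le_sqrt]; nlinarith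
    omega
  -- the graph: FMPTW's `H_p` with `n − 2p − 4p²` isolated vertices, relabelled on `Fin n`
  obtain ⟨pad, hpad⟩ : ∃ pad, n = 2 * p + 4 * p ^ 2 + pad := ⟨n - (2 * p + 4 * p ^ 2), by omega⟩
  have hcard : Fintype.card (SV p pad) = n := by rw [card_SV, hpad]
  let e : SV p pad ≃ Fin n := Fintype.equivFinOfCardEq hcard
  refine ⟨graphOn e, fun r hr hfac => ?_⟩
  have hr' : (r : ℝ) < (2 : ℝ) ^ ((1 / 8 : ℝ) * (p : ℝ) ^ ((2 : ℝ) / 13)) :=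
    hr.trans_le (Real.rpow_le_rpow_of_exponent_le one_le_two (exponent_le' hn100))
  obtain ⟨m, hmodd, -, hnot⟩ := hN₀ p hpN₀ r hr'
  exact hnot (hfac.patternMatrix_knapsackGap_of_stabSlack e hmodd)

end Literature.Combinatorics.Optimization

end
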